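import Literature.AlgebraicGeometry.Motives.HodgeStructureK3Type
import Literature.AlgebraicGeometry.Motives.HodgeStructureWeil
import Literature.NumberTheory.QuadraticForms.TransferForm
import Mathlib.Algebra.Algebra.Tower
import HarnessLib

/-!
# Pseudo-polarized Hodge structures of K3 type; real multiplication on a transfer `T_E(W)` (Bayer-Fluckiger–van Geemen–Schütt 2025, Def. 2.5 and Thm. 7.1)

Family `hodge`, layer `Literature/AlgebraicGeometry/Motives`, on top of the tree's rational Hodge
structures (`HodgeStructure V n` in filtration form, `piece`, `conj`, `IsOfK3Type`, `endAlg`;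
files `Motives/HodgeStructure`, `Motives/HodgeStructureK3Type`; `form_baseChange_conj` from
`Motives/HodgeStructureWeil`) and of the transfer / signature
vocabulary of `Literature/NumberTheory/QuadraticForms/TransferForm` (`transfer`, `HasSignature`).
`cite` item wi-11399 (route HodgeConjecture/EvenB2Twistor, crux `HyperholomorphicTransport`:
"the generic nodes" — very general K3-type Hodge structures on `T(W)` with endomorphism algebra
exactly `E`).

Source read (E. Bayer-Fluckiger, B. van Geemen, M. Schütt, *Non-projective K3 surfaces with real
or Salem multiplication*, arXiv:2511.19970; `lit read arxiv:2511.19970`, §2.5 and §7):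

* **Def. 2.5.** "A `ℚ`-vector space `T_ℚ` of dimension `r` with a non-degenerate bilinear form
  `( , )` of signature `(3, r - 3)` is called a pseudo-polarized rational Hodge structure of K3
  type if `T_ℚ` has a Hodge decomposition `T_ℂ = T^{2,0} ⊕ T^{1,1} ⊕ T^{0,2}` with
  `conj(T^{p,q}) = T^{q,p}`, and `dim T^{2,0} = 1`, and such that the subspace `T^{1,1}` is
  perpendicular to both `T^{2,0}` and `T^{0,2}` whereas if `ω ∈ T^{2,0}` is a basis of `T^{2,0}`
  then `(ω, ω) = 0`, `(ω, conj ω) > 0`." — "`A_T := {f ∈ End_ℚ(T_ℚ) : f(T^{p,q}) ⊂ T^{p,q}}`"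
  (the tree's `HodgeStructure.endAlg`).
* **Thm. 7.1.** "Let `E` be a totally real field of degree `d` and let `m > 2` be an integer. Let
  `W` be a quadratic form of dimension `m` over `E` and let `σ : E ↪ ℝ` an embedding such that
  the eigenspace `W_σ ⊂ W ⊗_ℚ ℝ` has signature `(2, m - 2)` or `(3, m - 3)`. Then there is an
  `(m - 2)`-dimensional family of pseudo-polarized K3 type Hodge structures on `T(W)` such that
  the Hodge endomorphism algebra of a very very general member in the family is `E`." Proof
  (p. 14): `ω` ranges over the non-empty open subset `Q⁺ = {(ω, conj ω) > 0}` of the quadric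
  `Q = {(ω, ω) = 0} ⊂ ℙ(W_{σ,ℂ})` of dimension `m - 2 ≥ 1`; `T^{2,0} := ℂ ω`, `T^{0,2} := ℂ conj ω`,
  `T^{1,1} := (T^{2,0} ⊕ T^{0,2})^⊥`; "By construction, `E ⊂ A_T`", and `E ≠ A_T` forces `ω` into
  one of countably many lower-dimensional subspaces, "So for a very general `ω ∈ Q⁺` we must
  have `E = A_T`."

## Content

* `HodgeStructure.IsPseudoPolarization H B` — Def. 2.5 for `H : HodgeStructure V 2` and a
  `ℚ`-bilinear form `B` on `V`: `B` symmetric of signature `(3, dim V - 3)` (`HasSignature` of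
  `B.toQuadraticMap`; this contains non-degeneracy and `dim V ≥ 3`), `H` of K3 type
  (`IsOfK3Type`: `h^{2,0} = 1`, only `V^{2,0}, V^{1,1}, V^{0,2}`; the decomposition and
  `conj V^{p,q} = V^{q,p}` come with `HodgeStructure`), `V^{1,1} ⊥ V^{2,0}, V^{0,2}` for `B_ℂ`,
  and `B_ℂ(ω, ω) = 0`, `B_ℂ(ω, conj ω) ∈ ℝ_{>0}` for `0 ≠ ω ∈ V^{2,0}`. A `Prop`-valued structure
  (mirrors the tree's `Polarization`, whose second Hodge–Riemann relation it replaces: the form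
  here has THREE positive squares and is NOT a polarization, §2.5). Proved API:
  `IsPseudoPolarization.finrank_eq`, `three_le_finrank`, `piece_two_zero_ne_bot`.
* The NAMED FACT `BFvGS2025_exists_pseudoPolarization_endAlg_eq` — Thm. 7.1 in EXISTENTIAL form
  (statement only): for `E` totally real, `m > 2`, `W = ⟨α₁, …, α_m⟩` a non-degenerate diagonal
  form on `E^m` (every form over `E` diagonalises, §3) and `σ : E →+* ℝ` with exactly `2` or `3`
  of the `σ(αᵢ)` positive (`W_σ` of signature `(2, m-2)` or `(3, m-3)`), and — the standing
  requirement of Def. 2.5, used implicitly in the source (its §10–§11 apply Thm. 7.1 only with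
  `T(W) ≃ U` of signature `(3, dm - 3)`) and made EXPLICIT here — `T(W)` of signature
  `(3, dm - 3)`: there EXISTS a Hodge structure `H` of weight `2` on the `ℚ`-space `E^m` which is
  pseudo-polarized by (the symmetric bilinear form `QuadraticMap.associated` of) `T_E(W)`, whose
  line `V^{2,0}` lies in the `σ`-eigenspace `W_{σ,ℂ}` of the `E`-action, and whose Hodge
  endomorphism algebra is EXACTLY the image of `E` in `End_ℚ(E^m)`. This is the very general
  member of the printed `(m - 2)`-dimensional family (non-empty: `Q⁺` is a non-empty open subset
  of a quadric of dimension `≥ 1`, minus countably many proper closed subsets); the family itself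
  (a map from `Q⁺`) and "very general" are not rendered.

NOT here: simplicity (`ω^⊥ ∩ T_ℚ = 0`) and Prop. 2.6; Thm. 2.7 / Thm. 1.2 (the Salem / totally
real dichotomy for `A_T`); Thm. 7.2 (Salem case); Thm. 1.3 (K3 SURFACES of algebraic dimension `0`
realising these Hodge structures via surjectivity of the period map — needs compact complex
surfaces, algebraic dimension and transcendental lattices, none of which the tree has; cite-only).

## References

* [BayerFluckigerVanGeemenSchuett2025] E. Bayer-Fluckiger, B. van Geemen, M. Schütt,
  *Non-projective K3 surfaces with real or Salem multiplication*, arXiv:2511.19970 (2025),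
  Def. 2.5, Prop. 2.6, Def. 3.2, Thm. 7.1 (read pp. 6–7, 8, 14 of the materialised text).
* [Huybrechts2016K3] D. Huybrechts, *Lectures on K3 Surfaces*, CUP 2016, Def. 3.2.3 (K3 type).
-/

noncomputable section

open scoped TensorProduct

universe u

namespace Literature.AlgebraicGeometry.Motives

namespace HodgeStructure

open Literature.NumberTheory.QuadraticForms

variable {V : Type u} [AddCommGroup V] [Module ℚ V]

/-! ### Pseudo-polarizations (Def. 2.5) -/

/-- **Pseudo-polarized rational Hodge structure of K3 type** (Bayer-Fluckiger–van Geemen–Schütt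
2025, Def. 2.5): the weight-`2` Hodge structure `H` on the finite-dimensional `ℚ`-space `V`
together with the `ℚ`-bilinear form `B` form a pseudo-polarized Hodge structure of K3 type when
`B` is symmetric, (non-degenerate) of signature `(3, dim V - 3)`, `H` is of K3 type
(`h^{2,0} = 1`, `V_ℂ = V^{2,0} ⊕ V^{1,1} ⊕ V^{0,2}`), `V^{1,1}` is `B_ℂ`-perpendicular to `V^{2,0}`
and to `V^{0,2}`, and for a generator `ω` of `V^{2,0}`: `B_ℂ(ω, ω) = 0` and `B_ℂ(ω, conj ω) > 0`
(real and positive). "Notice that it is not a polarization of the Hodge structure" (§2.5: three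
positive squares). Signature is `HasSignature` of the quadratic form `x ↦ B(x, x)` (diagonal over
`ℚ` with `3` positive and `dim V - 3` negative weights), which entails non-degeneracy.
[cite: BayerFluckigerVanGeemenSchuett2025, Def. 2.5] -/
structure IsPseudoPolarization [Module.Finite ℚ V] (H : HodgeStructure V 2)
    (B : LinearMap.BilinForm ℚ V) : Prop where
  /-- `B` is symmetric. -/
  isSymm : ∀ x y, B x y = B y x
  /-- `B` has signature `(3, dim V - 3)`. -/
  hasSignature : HasSignature B.toQuadraticMap 3 (Module.finrank ℚ V - 3)
  /-- `H` is of K3 type: `h^{2,0} = 1` and only `V^{2,0}, V^{1,1}, V^{0,2}` occur. -/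
  isOfK3Type : H.IsOfK3Type
  /-- `V^{1,1} ⊥ V^{2,0}`. -/
  orthogonal_two_zero : ∀ x ∈ H.piece 1 1, ∀ y ∈ H.piece 2 0, B.baseChange ℂ x y = 0
  /-- `V^{1,1} ⊥ V^{0,2}`. -/
  orthogonal_zero_two : ∀ x ∈ H.piece 1 1, ∀ y ∈ H.piece 0 2, B.baseChange ℂ x y = 0
  /-- `(ω, ω) = 0` on `V^{2,0}`. -/
  isotropic : ∀ ω ∈ H.piece 2 0, B.baseChange ℂ ω ω = 0
  /-- `(ω, conj ω) > 0` for `0 ≠ ω ∈ V^{2,0}`. -/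
  pos : ∀ ω ∈ H.piece 2 0, ω ≠ 0 → ∃ r : ℝ, 0 < r ∧ B.baseChange ℂ ω (conj ω) = r

namespace IsPseudoPolarization

variable [Module.Finite ℚ V] {H : HodgeStructure V 2} {B : LinearMap.BilinForm ℚ V}

/-- The dimension count behind "signature `(3, r - 3)`": `dim V = 3 + (dim V - 3)`, i.e. a
pseudo-polarized space has dimension at least `3`. [cite: BayerFluckigerVanGeemenSchuett2025,
Def. 2.5] -/
theorem finrank_eq (h : H.IsPseudoPolarization B) :
    Module.finrank ℚ V = 3 + (Module.finrank ℚ V - 3) := by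
  obtain ⟨w, -, -, ⟨e⟩⟩ := h.hasSignature
  have := e.toLinearEquiv.finrank_eq
  rw [Module.finrank_fintype_fun_eq_card, Fintype.card_sum, Fintype.card_fin,
    Fintype.card_fin] at this
  omega

/-- A pseudo-polarized Hodge structure of K3 type lives on a space of dimension `≥ 3` (three
positive squares). [cite: BayerFluckigerVanGeemenSchuett2025, Def. 2.5] -/
theorem three_le_finrank (h : H.IsPseudoPolarization B) : 3 ≤ Module.finrank ℚ V := by
  have := h.finrank_eq
  omega

/-- The line `V^{2,0}` of a pseudo-polarized Hodge structure of K3 type is non-zero.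
[cite: BayerFluckigerVanGeemenSchuett2025, Def. 2.5] -/
theorem piece_two_zero_ne_bot (h : H.IsPseudoPolarization B) : H.piece 2 0 ≠ ⊥ :=
  h.isOfK3Type.piece_two_zero_ne_bot

/-- `(conj ω, conj ω) = 0` as well ("notice that then also `(conj ω, conj ω) = 0`"): `conj`
maps `V^{0,2}` onto `V^{2,0}`, and `B_ℂ(conj x, conj y) = conj (B_ℂ(x, y))` for the
complexification of a rational form (`form_baseChange_conj`); so `V^{0,2}` is `B_ℂ`-isotropic.
[cite: BayerFluckigerVanGeemenSchuett2025, Def. 2.5] -/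
theorem isotropic_zero_two (h : H.IsPseudoPolarization B) :
    ∀ η ∈ H.piece 0 2, B.baseChange ℂ η η = 0 := by
  intro η hη
  have := h.isotropic (conj η) (H.conj_mem_piece hη)
  rwa [form_baseChange_conj, map_eq_zero] at this

end IsPseudoPolarization

/-! ### Real multiplication on a transfer (Thm. 7.1, named fact) -/

/-- **Bayer-Fluckiger–van Geemen–Schütt 2025, Thm. 7.1, existential form** (NAMED FACT, statement
only). Printed: for `E` totally real of degree `d`, `m > 2`, `W` a quadratic form of dimension `m`
over `E` and `σ : E ↪ ℝ` with `W_σ` of signature `(2, m-2)` or `(3, m-3)`, "there is an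
`(m-2)`-dimensional family of pseudo-polarized K3 type Hodge structures on `T(W)` such that the
Hodge endomorphism algebra of a very general member in the family is `E`." Rendering (module
docstring): `W = ⟨α₁, …, α_m⟩` diagonal and non-degenerate on `E^m`, exactly `2` or `3` of the
`σ(αᵢ)` positive, and — Def. 2.5's standing signature requirement, implicit in the source, made
explicit — `T_E(W)` of signature `(3, dm - 3)`; conclusion: there is a weight-`2` Hodge structure
`H` on the `ℚ`-space `E^m` with (i) `H` pseudo-polarized by the symmetric bilinear form of
`T_E(W)` (`QuadraticMap.associated`, `B(x, x) = Tr_{E/ℚ} W(x)`), (ii) `V^{2,0} ⊂ W_{σ,ℂ}`: every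
`e ∈ E` acts on `V^{2,0}` as the scalar `σ(e)`, and (iii) `A_T = E`: the Hodge endomorphism
algebra `H.endAlg` is exactly the image of `E → End_ℚ(E^m)`. (The very general member of the
printed family; the family and "very general" are not rendered.)
[cite: BayerFluckigerVanGeemenSchuett2025, Thm. 7.1] -/
def BFvGS2025_exists_pseudoPolarization_endAlg_eq : Prop :=
  ∀ ⦃E : Type u⦄ [Field E] [NumberField E] [NumberField.IsTotallyReal E] ⦃m : ℕ⦄, 2 < m →
  ∀ (α : Fin m → E), (∀ i, α i ≠ 0) →
  ∀ (σ : E →+* ℝ), ((Finset.univ.filter fun i => 0 < σ (α i)).card = 2 ∨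
      (Finset.univ.filter fun i => 0 < σ (α i)).card = 3) →
    HasSignature (transfer E (QuadraticMap.weightedSumSquares E α)) 3
      (Module.finrank ℚ E * m - 3) →
    ∃ H : HodgeStructure (Fin m → E) 2,
      H.IsPseudoPolarization
          (QuadraticMap.associated (transfer E (QuadraticMap.weightedSumSquares E α))) ∧
      (∀ e : E, ∀ ω ∈ H.piece 2 0,
        (Algebra.lsmul ℚ ℚ (Fin m → E) e).baseChange ℂ ω = ((σ e : ℝ) : ℂ) • ω) ∧
      H.endAlg = (Algebra.lsmul ℚ ℚ (Fin m → E) : E →ₐ[ℚ] Module.End ℚ (Fin m → E)).range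

end HodgeStructure

end Literature.AlgebraicGeometry.Motives
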